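import Summits.KontsevichZagierPeriods.KontsevichZagierPeriods.Theorems.LinRedNormalFormArrangementNormalFormStubRebaseSimplePosManyTools

/-!
# Stub `stub_rebaseSimplePosMany`, part `rebaseSimplePosMany_product` (crux `ArrangementNormalForm`, line `janus-bands`) — `Basic`

Basic facts on product representations over a base of dimension `B + 1` with `K` fibres
(`RebaseMany.IsProd`), the `B`-generic port of `RebaseZero`'s part `Basic`: coordinate bounds and
BOUNDEDNESS of a product domain over a base cell with bounded base coordinates
(`RebaseMany.isBounded_pDom`, registered as `rebaseSimplePosMany_isBounded_pDom`), restriction to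
product sub-domains, null / empty domains, the closure properties of the target predicate
`RebaseMany.Good`, the PACKAGING lemma `RebaseMany.good_of_allFmt` (all fibres in format ⟹
literally in `GG B 2 K`, `RebasePos.mem_GGset_two`), the transfer of the continuation
hypothesis `RebaseMany.HP` along the spectators, and its restriction `RebaseMany.HPc` to sub-cells
of a base cell (all moves keep or shrink the base cell).

References: M. Kontsevich, D. Zagier, *Periods* (2001), §1.2.
-/

noncomputable section

open Set MeasureTheory MvPolynomial
open Literature.NumberTheory.Transcendental Literature.ModelTheory.ExponentialFields

namespace Summit.KontsevichZagierPeriods.ArrangementNormalForm.JanusBands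

namespace RebaseMany

open SeparatePos RebasePos

variable {B K : ℕ}

/-! ### Bounds -/

/-- Atoms are bounded on coordinatewise bounded base points. [folklore] -/
theorem abs_affF_le (c : Cf B) {z : Fin (B + 1 + K) → ℝ} {R : ℝ}
    (hz : ∀ j : Fin (B + 1), |z (Fin.castAdd K j)| ≤ R) :
    |affF B K c z| ≤ (∑ j, |(c.1 j : ℝ)|) * R + |(c.2 : ℝ)| := by
  unfold affF
  refine (abs_add_le _ _).trans (add_le_add ?_ le_rfl)
  refine (Finset.abs_sum_le_sum_abs _ _).trans ?_
  rw [Finset.sum_mul]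
  refine Finset.sum_le_sum fun j _ => ?_
  rw [abs_mul]
  exact mul_le_mul_of_nonneg_left (hz j) (abs_nonneg _)

/-- Coordinate bounds on a product domain over a base cell with bounded base coordinates.
[folklore] -/
theorem abs_le_of_mem_pDom {m' : ℕ} (M : Fin m' → Cf B) (U V : Fin K → Cf B) {R : ℝ}
    (hR : ∀ z ∈ cell K M, ∀ j : Fin (B + 1), |z (Fin.castAdd K j)| ≤ R)
    {z : Fin (B + 1 + K) → ℝ} (hz : z ∈ pDom M U V) :
    (∀ j : Fin (B + 1), |z (Fin.castAdd K j)| ≤ R) ∧ ∀ i, |z (Fin.natAdd (B + 1) i)| ≤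
      ((∑ j, |((U i).1 j : ℝ)|) * R + |((U i).2 : ℝ)|) + ((∑ j, |((V i).1 j : ℝ)|) * R + |((V i).2 : ℝ)|) := by
  rw [mem_pDom] at hz
  have hb := hR z hz.1
  refine ⟨hb, fun i => ?_⟩
  obtain ⟨h1, h2⟩ := hz.2 i
  have hU := abs_affF_le (U i) hb
  have hV := abs_affF_le (V i) hb
  refine le_trans (abs_le.2 ⟨?_, ?_⟩) (add_le_add hU hV)
  · linarith [neg_abs_le (affF B K (U i) z), abs_nonneg (affF B K (V i) z)]
  · linarith [le_abs_self (affF B K (V i) z), abs_nonneg (affF B K (U i) z)]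

/-- **A product domain over a base cell with bounded base coordinates is bounded.** [folklore] -/
theorem isBounded_pDom {m' : ℕ} (M : Fin m' → Cf B) (U V : Fin K → Cf B) {R : ℝ}
    (hR : ∀ z ∈ cell K M, ∀ j : Fin (B + 1), |z (Fin.castAdd K j)| ≤ R) :
    Bornology.IsBounded (pDom M U V) := by
  set Bi : Fin K → ℝ := fun i => ((∑ j, |((U i).1 j : ℝ)|) * R + |((U i).2 : ℝ)|) +
    ((∑ j, |((V i).1 j : ℝ)|) * R + |((V i).2 : ℝ)|) with hBi
  refine IntegrateOutLow.isBounded_of_forall_abs_le (|R| + ∑ i, Bi i) fun z hz l => ?_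
  obtain ⟨hb, ht⟩ := abs_le_of_mem_pDom M U V hR hz
  have hBi0 : ∀ i, 0 ≤ Bi i := fun i => (abs_nonneg _).trans (ht i)
  have hsum : 0 ≤ ∑ i, Bi i := Finset.sum_nonneg fun i _ => hBi0 i
  refine Fin.addCases (fun j => ?_) (fun i => ?_) l
  · exact ((hb j).trans (le_abs_self R)).trans (le_add_of_nonneg_right hsum)
  · exact ((ht i).trans (Finset.single_le_sum (fun j _ => hBi0 j) (Finset.mem_univ i))).trans
      (le_add_of_nonneg_left (abs_nonneg R))

/-- The domain of a product representation is bounded. [folklore] -/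
theorem IsProd.bdd {s : KZ.IntegralRep (B + 1 + K)} {m' : ℕ} {M : Fin m' → Cf B} {U V : Fin K → Cf B}
    {T : BData B} {p : MvPolynomial (Fin B) ℚ} {a : Fin K → Option (Cf B)} (h : IsProd s M U V T p a) :
    Bornology.IsBounded s.domain := by
  obtain ⟨R, hR⟩ := h.cbd
  rw [h.dom]
  exact isBounded_pDom M U V hR

/-- Restricting a product representation to a product sub-domain over a smaller base cell.
[folklore] -/
theorem IsProd.restrict {s : KZ.IntegralRep (B + 1 + K)} {m' m'' : ℕ} {M : Fin m' → Cf B}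
    {U V : Fin K → Cf B} {T : BData B} {p : MvPolynomial (Fin B) ℚ} {a : Fin K → Option (Cf B)}
    (h : IsProd s M U V T p a) (M' : Fin m'' → Cf B) (U' V' : Fin K → Cf B)
    (hsub : pDom M' U' V' ⊆ s.domain) (hcell : cell K M' ⊆ cell K M) :
    IsProd (s.restrict _ (isSemialgebraic_pDom M' U' V') hsub) M' U' V' T p a := by
  obtain ⟨R, hR⟩ := h.cbd
  exact ⟨rfl, fun _ hz => h.int (hsub hz), h.adm, R, fun z hz => hR z (hcell hz)⟩

/-- The base cell with an extra row is smaller. [folklore] -/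
theorem cell_snoc_subset {m' : ℕ} (M : Fin m' → Cf B) (q : Cf B) :
    cell K (Fin.snoc M q : Fin (m' + 1) → Cf B) ⊆ cell K M := fun z hz =>
  ((mem_cell_snoc M q z).1 hz).1

/-! ### The target -/

/-- Elements of `GG B 2 K` are good. [folklore] -/
theorem good_of_mem {x : KZ.FormalRep} (h : x ∈ GGset B 2 K) : Good B K x :=
  ⟨x, AddSubgroup.subset_closure h, by simp⟩

/-- Relations are good. [folklore] -/
theorem good_of_mem_relations {x : KZ.FormalRep} (h : x ∈ KZ.relations) : Good B K x :=
  ⟨0, zero_mem _, by simpa using h⟩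

/-- A representation with null domain is good. [folklore] -/
theorem good_of_null (s : KZ.IntegralRep (B + 1 + K)) (h : volume s.domain = 0) :
    Good B K (KZ.of s) :=
  good_of_mem_relations (KZ.of_mem_relations_of_volume_eq_zero s h)

/-- A representation with empty domain is good. [folklore] -/
theorem good_of_empty (s : KZ.IntegralRep (B + 1 + K)) (h : s.domain = ∅) : Good B K (KZ.of s) :=
  good_of_null s (by rw [h, measure_empty])

/-- Goodness passes along relations. [folklore] -/
theorem good_of_sub_mem {x y : KZ.FormalRep} (h : x - y ∈ KZ.relations) (hy : Good B K y) :
    Good B K x := by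
  obtain ⟨c, hc, hyc⟩ := hy
  refine ⟨c, hc, ?_⟩
  have := add_mem h hyc
  rwa [sub_add_sub_cancel] at this

/-- Sums of good elements are good. [folklore] -/
theorem Good.add {x y : KZ.FormalRep} (hx : Good B K x) (hy : Good B K y) : Good B K (x + y) := by
  obtain ⟨c, hc, hxc⟩ := hx
  obtain ⟨d, hd, hyd⟩ := hy
  refine ⟨c + d, add_mem hc hd, ?_⟩
  have := add_mem hxc hyd
  rwa [show x - c + (y - d) = x + y - (c + d) by abel] at this

/-- Differences of good elements are good. [folklore] -/
theorem Good.sub {x y : KZ.FormalRep} (hx : Good B K x) (hy : Good B K y) : Good B K (x - y) := by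
  obtain ⟨c, hc, hxc⟩ := hx
  obtain ⟨d, hd, hyd⟩ := hy
  refine ⟨c - d, sub_mem hc hd, ?_⟩
  have := sub_mem hxc hyd
  rwa [show x - c - (y - d) = x - y - (c - d) by abel] at this

/-- Goodness from a three-term relation `[s] − [s₁] − [s₂] ∈ relations`. [folklore] -/
theorem good_of_rel3 {x y w : KZ.FormalRep} (h : x - y - w ∈ KZ.relations) (hy : Good B K y)
    (hw : Good B K w) : Good B K x :=
  good_of_sub_mem (by rwa [sub_add_eq_sub_sub]) (hy.add hw)

/-- Goodness from a Janus extension `[T] − [s] − [W] ∈ relations`. [folklore] -/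
theorem good_of_janus {x t w : KZ.FormalRep} (h : t - x - w ∈ KZ.relations) (ht : Good B K t)
    (hw : Good B K w) : Good B K x := by
  refine good_of_sub_mem ?_ (ht.sub hw)
  have := KZ.relations.neg_mem h
  rwa [show -(t - x - w) = x - (t - w) by abel] at this

/-- A product representation over an empty base cell is good. [folklore] -/
theorem good_of_cell_empty {s : KZ.IntegralRep (B + 1 + K)} {m' : ℕ} {M : Fin m' → Cf B}
    {U V : Fin K → Cf B} {T : BData B} {p : MvPolynomial (Fin B) ℚ} {a : Fin K → Option (Cf B)}
    (h : IsProd s M U V T p a) (hI : cell K M = ∅) : Good B K (KZ.of s) := by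
  refine good_of_empty s (Set.eq_empty_of_forall_notMem fun z hz => ?_)
  rw [h.dom, mem_pDom, hI] at hz
  exact hz.1

/-- A product representation one of whose fibres is empty over the base cell is good. [folklore] -/
theorem good_of_fibre_empty {s : KZ.IntegralRep (B + 1 + K)} {m' : ℕ} {M : Fin m' → Cf B}
    {U V : Fin K → Cf B} {T : BData B} {p : MvPolynomial (Fin B) ℚ} {a : Fin K → Option (Cf B)}
    (h : IsProd s M U V T p a) (i : Fin K) (hI : ∀ z ∈ cell K M, affF B K (V i) z ≤ affF B K (U i) z) :
    Good B K (KZ.of s) := by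
  refine good_of_empty s (Set.eq_empty_of_forall_notMem fun z hz => ?_)
  rw [h.dom, mem_pDom] at hz
  have h1 := (hz.2 i).1.trans (hz.2 i).2
  exact absurd (hI z hz.1) (not_le.2 h1)

/-! ### The format -/

/-- **Packaging.** A product representation all of whose fibres are in format is good (it is an
element of the literal class `GG B 2 K`). -/
theorem good_of_allFmt {s : KZ.IntegralRep (B + 1 + K)} {m' : ℕ} {M : Fin m' → Cf B}
    {U V : Fin K → Cf B} {T : BData B} {p : MvPolynomial (Fin B) ℚ} {a : Fin K → Option (Cf B)}
    (h : IsProd s M U V T p a) (hf : ∀ j, InFmt (a j) (U j) (V j)) : Good B K (KZ.of s) := by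
  refine good_of_mem (mem_GGset_two s M T.L T.e p T.ℓ₁ T.ℓ₂ a _ _ h.adm (fun i c hc => (hf i).1 c hc)
    (fun i c hc => ?_) h.bdd h.dom h.int)
  rcases hc with hc | hc <;> simp only [Sum.inr.injEq] at hc <;> subst hc
  · exact (hf i).2.1
  · exact (hf i).2.2

/-- The continuation hypothesis only sees the spectator fibres. [folklore] -/
theorem HP.transfer {T : BData B} {i : Fin K} {U V U' V' : Fin K → Cf B} {a a' : Fin K → Option (Cf B)}
    (hP : HP T i U V a) (hsame : ∀ j, j ≠ i → a' j = a j ∧ U' j = U j ∧ V' j = V j) :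
    HP T i U' V' a' := fun m' s M U'' V'' p a'' h hf hs =>
  hP m' s M U'' V'' p a'' h hf fun j hj => by
    obtain ⟨h1, h2, h3⟩ := hs j hj
    obtain ⟨h1', h2', h3'⟩ := hsame j hj
    exact ⟨h1.trans h1', h2.trans h2', h3.trans h3'⟩

/-- Updating fibre `i` only does not touch the spectators. [folklore] -/
theorem same_update (i : Fin K) (U V : Fin K → Cf B) (a : Fin K → Option (Cf B)) (u v : Cf B)
    (c : Option (Cf B)) : ∀ j, j ≠ i → Function.update a i c j = a j ∧
      Function.update U i u j = U j ∧ Function.update V i v j = V j := fun j hj => by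
  simp [Function.update_of_ne hj]

/-- Not touching anything does not touch the spectators. [folklore] -/
theorem same_rfl (i : Fin K) (U V : Fin K → Cf B) (a : Fin K → Option (Cf B)) :
    ∀ j, j ≠ i → a j = a j ∧ U j = U j ∧ V j = V j := fun _ _ => ⟨rfl, rfl, rfl⟩

/-- **Using the continuation hypothesis**: a product representation whose fibre `i` is in format
and whose spectators are those of `hP` is good. [folklore] -/
theorem HP.apply {T : BData B} {i : Fin K} {U V : Fin K → Cf B} {a : Fin K → Option (Cf B)}
    (hP : HP T i U V a) {s : KZ.IntegralRep (B + 1 + K)} {m' : ℕ} {M : Fin m' → Cf B}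
    {U' V' : Fin K → Cf B} {p : MvPolynomial (Fin B) ℚ} {a' : Fin K → Option (Cf B)}
    (h : IsProd s M U' V' T p a') (hf : InFmt (a' i) (U' i) (V' i))
    (hs : ∀ j, j ≠ i → a' j = a j ∧ U' j = U j ∧ V' j = V j) : Good B K (KZ.of s) :=
  hP _ s M U' V' p a' h hf hs

/-! ### The continuation hypothesis over sub-cells -/

/-- The continuation hypothesis of the fibre-by-fibre induction RESTRICTED TO SUB-CELLS of the base
cell `cell K M₀`: every product representation (same `T`) over a base cell contained in
`cell K M₀` whose fibre `i` is in format and whose other fibres carry the data `(a, U, V)` is good.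
All moves of the rebase keep or shrink the base cell, so this weaker promise suffices; it lets an
induction carry invariants of the spectators that are inherited by sub-cells (e.g. thickness).
[folklore] -/
def HPc (T : BData B) (i : Fin K) {m₀ : ℕ} (M₀ : Fin m₀ → Cf B) (U V : Fin K → Cf B)
    (a : Fin K → Option (Cf B)) : Prop :=
  ∀ (m' : ℕ) (s : KZ.IntegralRep (B + 1 + K)) (M : Fin m' → Cf B) (U' V' : Fin K → Cf B)
    (p : MvPolynomial (Fin B) ℚ) (a' : Fin K → Option (Cf B)), IsProd s M U' V' T p a' →
    cell K M ⊆ cell K M₀ → InFmt (a' i) (U' i) (V' i) →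
    (∀ j, j ≠ i → a' j = a j ∧ U' j = U j ∧ V' j = V j) → Good B K (KZ.of s)

/-- The full continuation hypothesis restricts to sub-cells. [folklore] -/
theorem HP.toHPc {T : BData B} {i : Fin K} {U V : Fin K → Cf B} {a : Fin K → Option (Cf B)}
    (hP : HP T i U V a) {m₀ : ℕ} (M₀ : Fin m₀ → Cf B) : HPc T i M₀ U V a :=
  fun m' s M U' V' p a' h _ hf hs => hP m' s M U' V' p a' h hf hs

/-- The restricted continuation hypothesis passes to smaller base cells. [folklore] -/
theorem HPc.mono {T : BData B} {i : Fin K} {m₀ m₁ : ℕ} {M₀ : Fin m₀ → Cf B} {M₁ : Fin m₁ → Cf B}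
    {U V : Fin K → Cf B} {a : Fin K → Option (Cf B)} (hP : HPc T i M₀ U V a)
    (hsub : cell K M₁ ⊆ cell K M₀) : HPc T i M₁ U V a :=
  fun m' s M U' V' p a' h hM hf hs => hP m' s M U' V' p a' h (hM.trans hsub) hf hs

/-- The restricted continuation hypothesis only sees the spectator fibres. [folklore] -/
theorem HPc.transfer {T : BData B} {i : Fin K} {m₀ : ℕ} {M₀ : Fin m₀ → Cf B} {U V U' V' : Fin K → Cf B}
    {a a' : Fin K → Option (Cf B)} (hP : HPc T i M₀ U V a)
    (hsame : ∀ j, j ≠ i → a' j = a j ∧ U' j = U j ∧ V' j = V j) : HPc T i M₀ U' V' a' :=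
  fun m' s M U'' V'' p a'' h hM hf hs =>
  hP m' s M U'' V'' p a'' h hM hf fun j hj => by
    obtain ⟨h1, h2, h3⟩ := hs j hj
    obtain ⟨h1', h2', h3'⟩ := hsame j hj
    exact ⟨h1.trans h1', h2.trans h2', h3.trans h3'⟩

/-- **Using the restricted continuation hypothesis.** [folklore] -/
theorem HPc.apply {T : BData B} {i : Fin K} {m₀ : ℕ} {M₀ : Fin m₀ → Cf B} {U V : Fin K → Cf B}
    {a : Fin K → Option (Cf B)} (hP : HPc T i M₀ U V a) {s : KZ.IntegralRep (B + 1 + K)} {m' : ℕ}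
    {M : Fin m' → Cf B} {U' V' : Fin K → Cf B} {p : MvPolynomial (Fin B) ℚ} {a' : Fin K → Option (Cf B)}
    (h : IsProd s M U' V' T p a') (hM : cell K M ⊆ cell K M₀) (hf : InFmt (a' i) (U' i) (V' i))
    (hs : ∀ j, j ≠ i → a' j = a j ∧ U' j = U j ∧ V' j = V j) : Good B K (KZ.of s) :=
  hP _ s M U' V' p a' h hM hf hs

end RebaseMany

/-- Registered support goal of this file: a product domain over a base cell with bounded base
coordinates is bounded. -/
theorem rebaseSimplePosMany_isBounded_pDom (B K m' : ℕ) (M : Fin m' → (Fin (B + 1) → ℚ) × ℚ) (U V : Fin K → (Fin (B + 1) → ℚ) × ℚ) (R : ℝ) (hR : ∀ z ∈ RebaseMany.cell K M, ∀ j : Fin (B + 1), |z (Fin.castAdd K j)| ≤ R) : Bornology.IsBounded (RebaseMany.pDom M U V) :=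
  RebaseMany.isBounded_pDom M U V hR

end Summit.KontsevichZagierPeriods.ArrangementNormalForm.JanusBands
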